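import Mathlib
import HarnessLib
import Literature.Analysis.ODE.RegularLevelCurvesFlowBox

/-!
# Route `LoopPeriodRatchet`, support `NoPlanarExtremum` (stmt-NavierStokesRegularity-22880) —
# helper I: a compact regular planar level set of a Hamiltonian carries closed orbits

Helper for the gen-1 child support `NoPlanarExtremum` of crux `OpenLoopLiouville` (D-0145 line
`LoopPeriodRatchet`, ideator ns-idea-1; bears on the DOOR rung N0-LocalTubeDoorPoloidal only; no summit
and no Clay option is proved here).

THE ODE FACT (coordinates `z = (z₀, z₁, z₂) ∈ ℝ³`, a `C²` function `G : ℝ³ → ℝ` with BOUNDED first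
partials `∂ᵢG`): the «horizontal Hamiltonian field» `X_G = (∂₁G, −∂₀G, 0)` is tangent to the planar
level sets `Γ(c,k) = {G = c} ∩ {z₂ = k}`. If such a level set is BOUNDED and REGULAR (`(∂₀G, ∂₁G) ≠ 0`
on it), then through every point of it passes a periodic orbit of `z′ = X_G(z)` with a positive period,
staying in `Γ(c,k)` (`exists_periodic_orbit_of_regular_planar_level`).

Proof = the tree's Khovanskii package `Literature.Analysis.ODE.LevelCurveData` (regular level curves
of `H : ℝ^{d+1} → ℝ^d` with a tangent field; the phase curves of a non-vanishing field on a regular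
level curve are lines or circles, `injective_or_periodic`, and lines are proper,
`tendsto_norm_traj_atTop`) with `d = 2`, `H = (G − c, z₂ − k)` and the tangent field `v = μ ε X_G`,
where the scalar `μ = 2/(1 + √(1 − 4ε²|X_G|²))` is chosen so that the package's bounded
renormalisation `v/(1 + Σ vⱼ²)` is EXACTLY `ε X_G` (`renorm_eq`); a bounded level curve cannot carry
an injective (proper) trajectory, so every trajectory on it is periodic, and the time change
`θ ↦ θ/ε` turns it into an orbit of `X_G` itself.

No new definitions, no named facts; nothing here bears on Navier–Stokes regularity.

## References

* A. G. Khovanskii, *Fewnomials*, Transl. Math. Monogr. 88 (AMS 1991), Ch. III §1 (phase curves of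
  a non-vanishing field on a regular level curve are lines or circles). [Khovanskii1991]
* P. Hartman, *Ordinary Differential Equations* (SIAM 2002), Ch. II Thm. 3.1 (continuation).
  [Hartman2002]
-/

noncomputable section

-- the summit and its single sub-problem share the name (CONVENTIONS §1), as in every Theorems file
set_option linter.dupNamespace false

namespace Summit.NavierStokesRegularity.NavierStokesRegularity.Theorems.NoPlanarExtremum

open Set Function Filter Topology Metric
open scoped ContDiff NNReal
open Literature.Analysis.ODE

/-! ### Scalar algebra of the exact renormalisation -/

/-- The scalar identity behind the exact renormalisation: with `μ = 2/(1 + √(1 − 4s))`,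
`μ/(1 + μ² s) = 1` for `0 ≤ s`, `4s < 1`. [folklore] -/
theorem mu_div_eq_one {s : ℝ} (hs' : 4 * s < 1) :
    (2 / (1 + Real.sqrt (1 - 4 * s))) / (1 + (2 / (1 + Real.sqrt (1 - 4 * s))) ^ 2 * s) = 1 := by
  set S := Real.sqrt (1 - 4 * s) with hS_def
  have hS : 0 ≤ S := Real.sqrt_nonneg _
  have hS2 : S ^ 2 = 1 - 4 * s := Real.sq_sqrt (by linarith)
  have hpos : 0 < 1 + S := by linarith
  have hden : (1 + S) ^ 2 + 4 * s = 2 * (1 + S) := by nlinarith [hS2]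
  have h1 : 1 + (2 / (1 + S)) ^ 2 * s = 2 / (1 + S) := by
    rw [div_pow, eq_div_iff hpos.ne']
    have : (1 + 2 ^ 2 / (1 + S) ^ 2 * s) * (1 + S) = ((1 + S) ^ 2 + 4 * s) / (1 + S) := by
      field_simp
      ring
    rw [this, hden, mul_div_assoc, div_self hpos.ne', mul_one]
  rw [h1, div_self (div_pos two_pos hpos).ne']

/-- `2/(1 + √(1 − 4s)) > 0`. [folklore] -/
theorem mu_pos (s : ℝ) : 0 < 2 / (1 + Real.sqrt (1 - 4 * s)) :=
  div_pos two_pos (by positivity)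

/-! ### Coordinates on `Fin 3 → ℝ` -/

/-- Expansion of a linear functional of `ℝ³` along the coordinate vectors:
`L w = Σᵢ wᵢ · L eᵢ`. [folklore] -/
theorem clm_apply_eq_sum (L : (Fin 3 → ℝ) →L[ℝ] ℝ) (w : Fin 3 → ℝ) :
    L w = ∑ i, w i * L (Pi.single i 1) := by
  conv_lhs => rw [← (Pi.basisFun ℝ (Fin 3)).sum_repr w]
  simp [map_sum, map_smul, Pi.basisFun_apply]

/-- The horizontal Hamiltonian vector `(b, −a, 0)` is annihilated by a functional with
`L e₀ = a`, `L e₁ = b`. [folklore] -/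
theorem clm_apply_ham_eq_zero (L : (Fin 3 → ℝ) →L[ℝ] ℝ) :
    L ![L (Pi.single 1 1), -L (Pi.single 0 1), 0] = 0 := by
  rw [clm_apply_eq_sum, Fin.sum_univ_three]
  simp
  ring

/-- Sum of squares of the coordinates of `(x, y, 0)`. [folklore] -/
theorem sum_sq_vec3 (x y : ℝ) : ∑ j : Fin 3, ((![x, y, 0] : Fin 3 → ℝ) j) ^ 2 = x ^ 2 + y ^ 2 := by
  rw [Fin.sum_univ_three]
  simp

/-! ### The level-curve datum of a planar Hamiltonian -/

variable {G : (Fin 3 → ℝ) → ℝ}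

/-- The first partials of a `C²` function are `C¹`. [folklore] -/
theorem contDiff_partial (hG : ContDiff ℝ 2 G) (e : Fin 3 → ℝ) :
    ContDiff ℝ 1 (fun z => fderiv ℝ G z e) := by
  have h := hG.fderiv_right (m := 1) (by norm_num)
  exact h.clm_apply contDiff_const

/-- **The Khovanskii datum of a bounded-gradient planar Hamiltonian.** For a `C²` function
`G : ℝ³ → ℝ` with `|∂ᵢG| ≤ B`, a level `c`, a height `k` such that `(∂₀G, ∂₁G) ≠ 0` on
`{G = c} ∩ {z₂ = k}`, and `ε = 1/(4(|B|+1))`: there is a `LevelCurveData 2` whose curve is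
`{G = c} ∩ {z₂ = k}` and whose renormalised field is EXACTLY `ε X_G`, `X_G = (∂₁G, −∂₀G, 0)`
(defining map `H = (G − c, z₂ − k)`, tangent field `v = μ ε X_G` with `μ = 2/(1+√(1−4ε²|X_G|²))`).
[cite: Khovanskii1991, Ch. III §1] -/
theorem exists_levelCurveData (hG : ContDiff ℝ 2 G) {c k B : ℝ}
    (hB : ∀ z (i : Fin 3), |fderiv ℝ G z (Pi.single i 1)| ≤ B)
    (hreg : ∀ z, G z = c → z 2 = k →
      fderiv ℝ G z (Pi.single 0 1) ≠ 0 ∨ fderiv ℝ G z (Pi.single 1 1) ≠ 0) :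
    ∃ (D : LevelCurveData 2) (ε : ℝ), 0 < ε ∧ (∀ z, z ∈ D.curve ↔ G z = c ∧ z 2 = k) ∧
      ∀ z, D.field z = ε • ![fderiv ℝ G z (Pi.single 1 1), -fderiv ℝ G z (Pi.single 0 1), 0] := by
  -- shorthand for the partials
  set a : (Fin 3 → ℝ) → ℝ := fun z => fderiv ℝ G z (Pi.single 0 1) with ha
  set b : (Fin 3 → ℝ) → ℝ := fun z => fderiv ℝ G z (Pi.single 1 1) with hb
  have hac : ContDiff ℝ 1 a := contDiff_partial hG _
  have hbc : ContDiff ℝ 1 b := contDiff_partial hG _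
  -- the scale `ε` and the bound `4 ε² (a² + b²) ≤ 1/2`
  set ε : ℝ := 1 / (4 * (|B| + 1)) with hε
  have hB0 : 0 < |B| + 1 := by positivity
  have hεpos : 0 < ε := by rw [hε]; positivity
  set s : (Fin 3 → ℝ) → ℝ := fun z => ε ^ 2 * (b z ^ 2 + a z ^ 2) with hs
  have hs0 : ∀ z, 0 ≤ s z := fun z => by simp only [hs]; positivity
  have hs1 : ∀ z, 4 * s z ≤ 1 / 2 := by
    intro z
    have h1 : a z ^ 2 ≤ (|B| + 1) ^ 2 := by
      have := (hB z 0).trans (le_abs_self B)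
      rw [← sq_abs]
      exact pow_le_pow_left₀ (abs_nonneg _) (by linarith) 2
    have h2 : b z ^ 2 ≤ (|B| + 1) ^ 2 := by
      have := (hB z 1).trans (le_abs_self B)
      rw [← sq_abs]
      exact pow_le_pow_left₀ (abs_nonneg _) (by linarith) 2
    have hε2 : ε ^ 2 * (|B| + 1) ^ 2 = 1 / 16 := by
      rw [hε]; field_simp; ring
    simp only [hs]
    nlinarith [hε2, sq_nonneg ε]
  have hs1' : ∀ z, 4 * s z < 1 := fun z => (hs1 z).trans_lt (by norm_num)
  have hroot : ∀ z, 1 / 2 ≤ 1 - 4 * s z := fun z => by linarith [hs1 z]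
  -- the renormalising scalar `μ`
  set μ : (Fin 3 → ℝ) → ℝ := fun z => 2 / (1 + Real.sqrt (1 - 4 * s z)) with hμ
  have hμpos : ∀ z, 0 < μ z := fun z => mu_pos (s z)
  have hsc : ContDiff ℝ 1 s := by
    simp only [hs]
    exact contDiff_const.mul ((hbc.pow 2).add (hac.pow 2))
  have hμc : ContDiff ℝ 1 μ := by
    simp only [hμ]
    refine contDiff_const.div (contDiff_const.add ((contDiff_const.sub
      (contDiff_const.mul hsc)).sqrt fun z => ?_)) fun z => ?_
    · exact (lt_of_lt_of_le (by norm_num) (hroot z)).ne'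
    · exact (lt_of_lt_of_le zero_lt_one (le_add_of_nonneg_right (Real.sqrt_nonneg _))).ne'
  -- the datum
  refine ⟨{ H := fun z i => (![G z - c, z 2 - k] : Fin 2 → ℝ) i,
            v := fun z => (μ z * ε) • (![b z, -a z, 0] : Fin 3 → ℝ),
            contDiff_H := ?_, contDiff_v := ?_, fderiv_H_v := ?_, v_ne_zero := ?_,
            surjective_fderiv := ?_ }, ε, hεpos, ?_, ?_⟩
  · -- `H` is `C¹`
    refine contDiff_pi.2 fun i => ?_
    fin_cases i
    · simpa using (hG.of_le (by norm_num : (1 : WithTop ℕ∞) ≤ 2)).sub contDiff_const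
    · simpa using ((contDiff_apply ℝ ℝ (2 : Fin 3)).of_le le_top).sub contDiff_const
  · -- `v` is `C¹`
    refine (hμc.mul contDiff_const).smul (contDiff_pi.2 fun i => ?_)
    fin_cases i
    · simpa using hbc
    · simpa using hac.neg
    · simpa using contDiff_const
  · -- tangency `dH(v) = 0`
    intro z
    have hd : HasFDerivAt (fun z : Fin 3 → ℝ => fun i : Fin 2 => (![G z - c, z 2 - k] : Fin 2 → ℝ) i)
        (ContinuousLinearMap.pi ![fderiv ℝ G z, ContinuousLinearMap.proj 2]) z := by
      rw [hasFDerivAt_pi]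
      intro i
      fin_cases i
      · simpa using ((hG.differentiable (by norm_num)) z).hasFDerivAt.sub_const c
      · simpa using ((ContinuousLinearMap.proj (R := ℝ) (φ := fun _ : Fin 3 => ℝ) 2).hasFDerivAt).sub_const k
    rw [hd.fderiv]
    funext i
    fin_cases i
    · simp only [ContinuousLinearMap.pi_apply, map_smul, smul_eq_mul]
      simp [ha, hb, clm_apply_ham_eq_zero]
    · simp
  · -- `v ≠ 0` on the curve
    intro z hz
    have h0 : G z = c := by simpa [sub_eq_zero] using congrFun hz 0
    have h2 : z 2 = k := by simpa [sub_eq_zero] using congrFun hz 1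
    have hne := hreg z h0 h2
    intro hv
    have hsmul := (smul_eq_zero.1 hv).resolve_left (mul_pos (hμpos z) hεpos).ne'
    have e0 : b z = 0 := by simpa using congrFun hsmul 0
    have e1 : a z = 0 := by simpa using congrFun hsmul 1
    exact hne.elim (fun h => h e1) (fun h => h e0)
  · -- `dH` is onto on the curve
    intro z hz
    have h0 : G z = c := by simpa [sub_eq_zero] using congrFun hz 0
    have h2 : z 2 = k := by simpa [sub_eq_zero] using congrFun hz 1
    have hne := hreg z h0 h2
    have hd : HasFDerivAt (fun z : Fin 3 → ℝ => fun i : Fin 2 => (![G z - c, z 2 - k] : Fin 2 → ℝ) i)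
        (ContinuousLinearMap.pi ![fderiv ℝ G z, ContinuousLinearMap.proj 2]) z := by
      rw [hasFDerivAt_pi]
      intro i
      fin_cases i
      · simpa using ((hG.differentiable (by norm_num)) z).hasFDerivAt.sub_const c
      · simpa using ((ContinuousLinearMap.proj (R := ℝ) (φ := fun _ : Fin 3 => ℝ) 2).hasFDerivAt).sub_const k
    rw [hd.fderiv]
    have hn : 0 < a z ^ 2 + b z ^ 2 := by
      rcases hne with h | h
      · have : 0 < a z ^ 2 := by positivity
        positivity
      · have : 0 < b z ^ 2 := by positivity
        positivity
    intro t
    set d : ℝ := fderiv ℝ G z (Pi.single 2 1) with hd'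
    set q : ℝ := (t 0 - t 1 * d) / (a z ^ 2 + b z ^ 2) with hq
    refine ⟨(q * a z) • Pi.single 0 1 + (q * b z) • Pi.single 1 1 + (t 1) • Pi.single 2 1, ?_⟩
    funext i
    fin_cases i
    · simp only [ContinuousLinearMap.pi_apply, map_add, map_smul, smul_eq_mul]
      simp only [Fin.zero_eta, Matrix.cons_val_zero]
      show q * a z * a z + q * b z * b z + t 1 * d = t 0
      have : q * (a z ^ 2 + b z ^ 2) = t 0 - t 1 * d := by
        rw [hq, div_mul_cancel₀ _ hn.ne']
      nlinarith [this]
    · simp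
  · -- the curve is the planar level set
    intro z
    show (fun i : Fin 2 => (![G z - c, z 2 - k] : Fin 2 → ℝ) i) = 0 ↔ _
    constructor
    · intro hz
      exact ⟨by simpa [sub_eq_zero] using congrFun hz 0, by simpa [sub_eq_zero] using congrFun hz 1⟩
    · rintro ⟨h0, h2⟩
      funext i
      fin_cases i
      · simp [h0]
      · simp [h2]
  · -- the renormalised field is exactly `ε X_G`
    intro z
    show (1 + ∑ j, (((μ z * ε) • (![b z, -a z, 0] : Fin 3 → ℝ)) j) ^ 2)⁻¹ •
        ((μ z * ε) • (![b z, -a z, 0] : Fin 3 → ℝ)) = ε • ![b z, -a z, 0]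
    have hsum : ∑ j, (((μ z * ε) • (![b z, -a z, 0] : Fin 3 → ℝ)) j) ^ 2 = μ z ^ 2 * s z := by
      rw [Fin.sum_univ_three]
      simp [hs]
      ring
    rw [hsum, smul_smul]
    congr 1
    have key := mu_div_eq_one (hs1' z)
    rw [div_eq_iff (by nlinarith [hμpos z, hs0 z] : (1 + (2 / (1 + Real.sqrt (1 - 4 * s z))) ^ 2 * s z) ≠ 0)] at key
    have hμ' : μ z = 2 / (1 + Real.sqrt (1 - 4 * s z)) := rfl
    rw [← hμ'] at key
    have hne : 1 + μ z ^ 2 * s z ≠ 0 := by nlinarith [hμpos z, hs0 z]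
    field_simp
    linarith [key]

/-- **Closed orbits on a compact regular planar level set.** Let `G : ℝ³ → ℝ` be `C²` with bounded
first partials, and let the planar level set `Γ = {G = c} ∩ {z₂ = k}` be bounded and regular
(`(∂₀G, ∂₁G) ≠ 0` on `Γ`). Then through every point `z₁ ∈ Γ` passes a periodic orbit, with a
positive period, of the horizontal Hamiltonian field `z′ = (∂₁G(z), −∂₀G(z), 0)`, and the orbit
stays in `Γ`. (Khovanskii: on a regular level curve the phase curves of a non-vanishing tangent field
are lines or circles, and lines run off to infinity.) [cite: Khovanskii1991, Ch. III §1] -/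
theorem exists_periodic_orbit_of_regular_planar_level (hG : ContDiff ℝ 2 G) {c k B R : ℝ}
    (hB : ∀ z (i : Fin 3), |fderiv ℝ G z (Pi.single i 1)| ≤ B)
    (hR : ∀ z, G z = c → z 2 = k → ‖z‖ ≤ R)
    (hreg : ∀ z, G z = c → z 2 = k →
      fderiv ℝ G z (Pi.single 0 1) ≠ 0 ∨ fderiv ℝ G z (Pi.single 1 1) ≠ 0)
    {z₁ : Fin 3 → ℝ} (hz₁ : G z₁ = c) (hz₁k : z₁ 2 = k) :
    ∃ (γ : ℝ → Fin 3 → ℝ) (ℓ : ℝ), 0 < ℓ ∧ γ 0 = z₁ ∧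
      (∀ θ, HasDerivAt γ
        (![fderiv ℝ G (γ θ) (Pi.single 1 1), -fderiv ℝ G (γ θ) (Pi.single 0 1), 0]) θ) ∧
      (∀ θ, γ (θ + ℓ) = γ θ) ∧ (∀ θ, G (γ θ) = c ∧ γ θ 2 = k) := by
  obtain ⟨D, ε, hε, hcurve, hfield⟩ := exists_levelCurveData hG hB hreg
  have hz : z₁ ∈ D.curve := (hcurve z₁).2 ⟨hz₁, hz₁k⟩
  -- every trajectory in the (bounded) curve is periodic
  obtain ⟨T, hT, hper, -⟩ : ∃ T > 0, (∀ t, D.traj z₁ (t + T) = D.traj z₁ t) ∧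
      ∀ a, InjOn (D.traj z₁) (Ico a (a + T)) := by
    refine (D.injective_or_periodic hz).resolve_left fun hinj => ?_
    have hlim := D.tendsto_norm_traj_atTop hz hinj
    obtain ⟨t, ht⟩ := (hlim.eventually (eventually_gt_atTop R)).exists
    have hmem := (hcurve _).1 (D.traj_mem_curve hz t)
    exact (lt_irrefl R) (ht.trans_le (hR _ hmem.1 hmem.2))
  -- time change `θ ↦ θ / ε`
  refine ⟨fun θ => D.traj z₁ (θ / ε), ε * T, mul_pos hε hT, by simp, fun θ => ?_, fun θ => ?_,
    fun θ => (hcurve _).1 (D.traj_mem_curve hz _)⟩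
  · have h := (D.hasDerivAt_traj z₁ (θ / ε)).scomp θ ((hasDerivAt_id θ).div_const ε)
    rw [hfield, smul_smul, div_mul_cancel₀ _ hε.ne', one_smul] at h
    exact h
  · show D.traj z₁ ((θ + ε * T) / ε) = D.traj z₁ (θ / ε)
    rw [add_div, mul_div_cancel_left₀ _ hε.ne', hper]

end Summit.NavierStokesRegularity.NavierStokesRegularity.Theorems.NoPlanarExtremum
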